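import Summits.QuantumFields.YangMills.Theorems.FradkinShenkerFlowClusteringToYangMillsStubCylinderApprox
import Summits.QuantumFields.YangMills.Theorems.FradkinShenkerFlowClusteringToYangMillsStubReconstructibleGeometry
import HarnessLib

/-!
# `stub_admissibleGivesGap`, helper 1/4: `L²` bookkeeping for OS integrands and invariances of
# odd-torus limit states

Support file for crux `stmt-QuantumFields-8762`
(`Summit.QuantumFields.YangMills.Theses.EquipartitionCriticality.CriticalContinuumLimit`), line
`Sketch`, stub `stub_admissibleGivesGap` (I0 = RQ of line `spectral-requantisation-dock` of crux
`ClusteringToYangMills`, stmt-QuantumFields-9443): torus clustering at `β` with rate `m` ⟹ every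
odd-torus limit state is OS-reconstructible with transfer gap `≥ m`. The stub is assembled in
`EquipartitionCriticalityCriticalContinuumLimitStubAdmissibleGivesGap.lean` from four helper files
(`…LTwo`, `…TorusRP`, `…Gauge`, `…GaugeInvariance`) and the landed RQ0/RQb2 of 9443.

**This file.** (i) Abstract `L²` estimates for OS integrands `∫ F̄∘Θ · F∘σ dμ` with
measure-preserving `Θ, σ` (`norm_osIntegral_sub_le`), and the extension principle
`re_integral_nonneg_of_approx`: positivity of `Re ∫ F̄∘Θ · F∘σ` survives `L²(μ)` approximation of
`F`. (ii) Transport of symmetries of the torus Wilson states to odd-torus limit states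
(`integral_comp_eq_of_torus`): `Θ`-invariance and `τ`-invariance of every odd-torus limit state
(`map_gaugeTimeReflect_eq`, `map_gaugeTimeShift_eq`; registered as `admissibleGap_limitInvariance`),
from `Θ_T`- and translation invariance of the Wilson states and the intertwining
`Θ ∘ lift = lift ∘ T_{-2e₀} ∘ Θ_T`, `τ ∘ lift = lift ∘ T_{-e₀}`, given `CylinderExt G`.

References: K. Osterwalder, E. Seiler, Ann. Phys. 110 (1978) 440, §2; E. Seiler, LNP 159 (1982)
Ch. 2; J. Glimm, A. Jaffe, *Quantum Physics* (1987) §6.1; J. Fröhlich, R. Israel, E. Lieb,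
B. Simon, Comm. Math. Phys. 62 (1978) 1, §2–3.
-/

noncomputable section

open scoped BigOperators Topology ENNReal ComplexConjugate ComplexOrder
open MeasureTheory Filter
open Literature.MathematicalPhysics Literature.MathematicalPhysics.QuantumFieldTheory
  Literature.MathematicalPhysics.QuantumLattice
open Literature.Probability.LatticeModels (IsOSReconstructible IsBoundedMeasurable positiveEvents osForm)

namespace Summit.QuantumFields.YangMills.Theorems.CriticalContinuumLimit.AdmissibleGap

open Summit.QuantumFields.YangMills.Theorems.ClusteringToYangMills
open Summit.QuantumFields.YangMills.Theorems.ClusteringToYangMills.Reconstructible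

/-! ### Abstract `L²` bookkeeping for OS integrands -/

section Abstract

variable {Ω : Type*} [MeasurableSpace Ω]

/-- `‖x̄ y‖ ≤ (‖x‖²/δ + δ‖y‖²)/2`. [folklore] -/
theorem norm_conj_mul_le (x y : ℂ) {δ : ℝ} (hδ : 0 < δ) :
    ‖conj x * y‖ ≤ (‖x‖ ^ 2 / δ + δ * ‖y‖ ^ 2) / 2 := by
  rw [norm_mul, Complex.norm_conj, le_div_iff₀ two_pos, div_add' _ _ _ hδ.ne', le_div_iff₀ hδ]
  nlinarith [sq_nonneg (‖x‖ - δ * ‖y‖), norm_nonneg x, norm_nonneg y]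

/-- Bounded measurable complex functions are square integrable against a finite measure. [folklore] -/
theorem integrable_norm_sq (μ : Measure Ω) [IsFiniteMeasure μ] {φ : Ω → ℂ} (hφ : Measurable φ)
    {A : ℝ} (hA : ∀ x, ‖φ x‖ ≤ A) : Integrable (fun x => ‖φ x‖ ^ 2) μ := by
  refine Integrable.of_bound (hφ.norm.pow_const 2).aestronglyMeasurable (A ^ 2)
    (ae_of_all _ fun x => ?_)
  rw [norm_pow, norm_norm]
  exact pow_le_pow_left₀ (norm_nonneg _) (hA x) 2

/-- The basic estimate `‖∫ φ̄ ψ‖ ≤ (∫‖φ‖²/δ + δ ∫‖ψ‖²)/2`. [folklore] -/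
theorem norm_integral_conj_mul_le (μ : Measure Ω) [IsFiniteMeasure μ] {φ ψ : Ω → ℂ}
    (hφ : Measurable φ) (hψ : Measurable ψ) {A B : ℝ} (hA : ∀ x, ‖φ x‖ ≤ A) (hB : ∀ x, ‖ψ x‖ ≤ B)
    {δ : ℝ} (hδ : 0 < δ) :
    ‖∫ x, conj (φ x) * ψ x ∂μ‖ ≤ ((∫ x, ‖φ x‖ ^ 2 ∂μ) / δ + δ * ∫ x, ‖ψ x‖ ^ 2 ∂μ) / 2 := by
  calc ‖∫ x, conj (φ x) * ψ x ∂μ‖ ≤ ∫ x, ‖conj (φ x) * ψ x‖ ∂μ := norm_integral_le_integral_norm _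
    _ ≤ ∫ x, (‖φ x‖ ^ 2 / δ + δ * ‖ψ x‖ ^ 2) / 2 ∂μ := by
        refine integral_mono_of_nonneg (ae_of_all _ fun x => norm_nonneg _) ?_
          (ae_of_all _ fun x => norm_conj_mul_le _ _ hδ)
        exact (((integrable_norm_sq μ hφ hA).div_const δ).add
          ((integrable_norm_sq μ hψ hB).const_mul δ)).div_const 2
    _ = ((∫ x, ‖φ x‖ ^ 2 ∂μ) / δ + δ * ∫ x, ‖ψ x‖ ^ 2 ∂μ) / 2 := by
        rw [integral_div, integral_add ((integrable_norm_sq μ hφ hA).div_const δ)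
          ((integrable_norm_sq μ hψ hB).const_mul δ), integral_div, integral_const_mul]

/-- **Perturbation of the OS integrand.** For bounded measurable `F, F'`, measure-preserving
`Θ, σ` and `0 < δ`:
`‖∫ F̄∘Θ · F∘σ - ∫ F̄'∘Θ · F'∘σ‖ ≤ E/δ + δ (2 ∫‖F‖² + E)`, `E = ∫ ‖F - F'‖²`. [folklore] -/
theorem norm_osIntegral_sub_le (μ : Measure Ω) [IsFiniteMeasure μ] (eΘ eσ : Ω ≃ᵐ Ω)
    (hμΘ : μ.map eΘ = μ) (hμσ : μ.map eσ = μ) {F F' : Ω → ℂ} (hF : Measurable F)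
    (hF' : Measurable F') {C C' : ℝ} (hC : ∀ x, ‖F x‖ ≤ C) (hC' : ∀ x, ‖F' x‖ ≤ C') {δ : ℝ}
    (hδ : 0 < δ) :
    ‖(∫ x, conj (F (eΘ x)) * F (eσ x) ∂μ) - ∫ x, conj (F' (eΘ x)) * F' (eσ x) ∂μ‖ ≤
      (∫ x, ‖F x - F' x‖ ^ 2 ∂μ) / δ +
        δ * (2 * ∫ x, ‖F x‖ ^ 2 ∂μ + ∫ x, ‖F x - F' x‖ ^ 2 ∂μ) := by
  -- bounds and measurability of the pieces
  have hDm : Measurable fun x => F x - F' x := hF.sub hF'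
  have hDb : ∀ x, ‖F x - F' x‖ ≤ C + C' := fun x => (norm_sub_le _ _).trans (add_le_add (hC x) (hC' x))
  have hDΘm : Measurable fun x => F (eΘ x) - F' (eΘ x) := hDm.comp eΘ.measurable
  have hFσm : Measurable fun x => F (eσ x) := hF.comp eσ.measurable
  have hF'Θm : Measurable fun x => F' (eΘ x) := hF'.comp eΘ.measurable
  have hDσm : Measurable fun x => F (eσ x) - F' (eσ x) := hDm.comp eσ.measurable
  -- invariance of the `L²` quantities
  have hIΘ : ∫ x, ‖F (eΘ x) - F' (eΘ x)‖ ^ 2 ∂μ = ∫ x, ‖F x - F' x‖ ^ 2 ∂μ := by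
    rw [← integral_map_equiv eΘ (fun x => ‖F x - F' x‖ ^ 2), hμΘ]
  have hIσ : ∫ x, ‖F (eσ x) - F' (eσ x)‖ ^ 2 ∂μ = ∫ x, ‖F x - F' x‖ ^ 2 ∂μ := by
    rw [← integral_map_equiv eσ (fun x => ‖F x - F' x‖ ^ 2), hμσ]
  have hIF : ∫ x, ‖F (eσ x)‖ ^ 2 ∂μ = ∫ x, ‖F x‖ ^ 2 ∂μ := by
    rw [← integral_map_equiv eσ (fun x => ‖F x‖ ^ 2), hμσ]
  have hIF' : ∫ x, ‖F' (eΘ x)‖ ^ 2 ∂μ = ∫ x, ‖F' x‖ ^ 2 ∂μ := by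
    rw [← integral_map_equiv eΘ (fun x => ‖F' x‖ ^ 2), hμΘ]
  -- `∫‖F'‖² ≤ 2∫‖F‖² + 2E`
  have hF'2 : ∫ x, ‖F' x‖ ^ 2 ∂μ ≤ 2 * ∫ x, ‖F x‖ ^ 2 ∂μ + 2 * ∫ x, ‖F x - F' x‖ ^ 2 ∂μ := by
    rw [← integral_const_mul, ← integral_const_mul, ← integral_add
      ((integrable_norm_sq μ hF hC).const_mul 2) ((integrable_norm_sq μ hDm hDb).const_mul 2)]
    refine integral_mono (integrable_norm_sq μ hF' hC')
      (((integrable_norm_sq μ hF hC).const_mul 2).add ((integrable_norm_sq μ hDm hDb).const_mul 2))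
      fun x => ?_
    have h := norm_sub_sq_le_two_mul (F' x) (F x) 0
    rw [sub_zero, sub_zero, norm_sub_rev (F' x) (F x)] at h
    linarith
  -- split the difference
  have hint : ∀ {φ ψ : Ω → ℂ}, Measurable φ → Measurable ψ → ∀ {A B : ℝ}, (∀ x, ‖φ x‖ ≤ A) →
      (∀ x, ‖ψ x‖ ≤ B) → Integrable (fun x => conj (φ x) * ψ x) μ := by
    intro φ ψ hφ hψ A B hA hB
    refine Integrable.of_bound ((Complex.continuous_conj.measurable.comp hφ).mul hψ
      |>.aestronglyMeasurable) (A * B) (ae_of_all _ fun x => ?_)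
    rw [norm_mul, Complex.norm_conj]
    exact mul_le_mul (hA _) (hB _) (norm_nonneg _) ((norm_nonneg _).trans (hA x))
  have i1 := hint hDΘm hFσm (fun x => hDb _) (fun x => hC _)
  have i2 := hint hF'Θm hDσm (fun x => hC' _) (fun x => hDb _)
  have iA : Integrable (fun x => conj (F (eΘ x)) * F (eσ x)) μ :=
    hint (hF.comp eΘ.measurable) hFσm (fun x => hC _) (fun x => hC _)
  have iB : Integrable (fun x => conj (F' (eΘ x)) * F' (eσ x)) μ :=
    hint hF'Θm (hF'.comp eσ.measurable) (fun x => hC' _) (fun x => hC' _)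
  have hsplit : (∫ x, conj (F (eΘ x)) * F (eσ x) ∂μ) - ∫ x, conj (F' (eΘ x)) * F' (eσ x) ∂μ =
      (∫ x, conj (F (eΘ x) - F' (eΘ x)) * F (eσ x) ∂μ) +
        ∫ x, conj (F' (eΘ x)) * (F (eσ x) - F' (eσ x)) ∂μ := by
    rw [← integral_sub iA iB, ← integral_add i1 i2]
    refine integral_congr_ae (ae_of_all _ fun x => ?_)
    simp only [map_sub]
    ring
  rw [hsplit]
  have h1 := norm_integral_conj_mul_le μ hDΘm hFσm (fun x => hDb _) (fun x => hC _) hδ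
  have h2 := norm_integral_conj_mul_le μ hF'Θm hDσm (fun x => hC' _) (fun x => hDb _)
    (inv_pos.2 hδ)
  rw [hIΘ, hIF] at h1
  rw [hIF', hIσ, div_inv_eq_mul, inv_mul_eq_div] at h2
  have hE0 : 0 ≤ ∫ x, ‖F x - F' x‖ ^ 2 ∂μ := integral_nonneg fun x => by positivity
  have hM0 : 0 ≤ ∫ x, ‖F x‖ ^ 2 ∂μ := integral_nonneg fun x => by positivity
  calc ‖(∫ x, conj (F (eΘ x) - F' (eΘ x)) * F (eσ x) ∂μ) +
          ∫ x, conj (F' (eΘ x)) * (F (eσ x) - F' (eσ x)) ∂μ‖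
      ≤ ((∫ x, ‖F x - F' x‖ ^ 2 ∂μ) / δ + δ * ∫ x, ‖F x‖ ^ 2 ∂μ) / 2 +
          ((∫ x, ‖F' x‖ ^ 2 ∂μ) * δ + (∫ x, ‖F x - F' x‖ ^ 2 ∂μ) / δ) / 2 :=
        (norm_add_le _ _).trans (add_le_add h1 h2)
    _ ≤ (∫ x, ‖F x - F' x‖ ^ 2 ∂μ) / δ +
          δ * (2 * ∫ x, ‖F x‖ ^ 2 ∂μ + ∫ x, ‖F x - F' x‖ ^ 2 ∂μ) := by
        have hd0 : 0 ≤ (∫ x, ‖F x - F' x‖ ^ 2 ∂μ) / δ := div_nonneg hE0 hδ.le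
        nlinarith [mul_le_mul_of_nonneg_right hF'2 hδ.le, mul_nonneg hδ.le hM0,
          mul_nonneg hδ.le hE0]

/-- **Positivity survives `L²` approximation.** If `F` is bounded measurable and for every
`ε > 0` there is a bounded measurable `F'` with `∫ ‖F - F'‖² ≤ ε` and
`0 ≤ Re ∫ F̄'∘Θ · F'∘σ`, for measure-preserving `Θ, σ`, then `0 ≤ Re ∫ F̄∘Θ · F∘σ`. [folklore] -/
theorem re_integral_nonneg_of_approx (μ : Measure Ω) [IsFiniteMeasure μ] (eΘ eσ : Ω ≃ᵐ Ω)
    (hμΘ : μ.map eΘ = μ) (hμσ : μ.map eσ = μ) {F : Ω → ℂ} (hF : Measurable F) {C : ℝ}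
    (hC : ∀ x, ‖F x‖ ≤ C)
    (happrox : ∀ ε : ℝ, 0 < ε → ∃ F' : Ω → ℂ, Measurable F' ∧ (∃ C' : ℝ, ∀ x, ‖F' x‖ ≤ C') ∧
      ∫ x, ‖F x - F' x‖ ^ 2 ∂μ ≤ ε ∧ 0 ≤ (∫ x, conj (F' (eΘ x)) * F' (eσ x) ∂μ).re) :
    0 ≤ (∫ x, conj (F (eΘ x)) * F (eσ x) ∂μ).re := by
  set M : ℝ := ∫ x, ‖F x‖ ^ 2 ∂μ with hM
  have hM0 : 0 ≤ M := integral_nonneg fun x => by positivity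
  refine le_of_forall_pos_le_add fun η hη => ?_
  -- choose `δ` and `ε`
  set δ : ℝ := min 1 (η / (2 * M + 2)) with hδdef
  have hδ : 0 < δ := lt_min one_pos (div_pos hη (by linarith))
  have hδ1 : δ ≤ 1 := min_le_left _ _
  have hδη : δ * (2 * M + 2) ≤ η := by
    have : δ ≤ η / (2 * M + 2) := min_le_right _ _
    rwa [le_div_iff₀ (by linarith)] at this
  obtain ⟨F', hF'm, ⟨C', hC'⟩, hE, hpos⟩ := happrox (δ ^ 2) (by positivity)
  have hE0 : 0 ≤ ∫ x, ‖F x - F' x‖ ^ 2 ∂μ := integral_nonneg fun x => by positivity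
  have key := norm_osIntegral_sub_le μ eΘ eσ hμΘ hμσ hF hF'm hC hC' hδ
  have hbound : (∫ x, ‖F x - F' x‖ ^ 2 ∂μ) / δ +
      δ * (2 * ∫ x, ‖F x‖ ^ 2 ∂μ + ∫ x, ‖F x - F' x‖ ^ 2 ∂μ) ≤ η := by
    have h1 : (∫ x, ‖F x - F' x‖ ^ 2 ∂μ) / δ ≤ δ := by
      rw [div_le_iff₀ hδ]; nlinarith
    have h2 : ∫ x, ‖F x - F' x‖ ^ 2 ∂μ ≤ 1 := hE.trans (by nlinarith)
    calc _ ≤ δ + δ * (2 * M + 1) := add_le_add h1 (by rw [← hM]; nlinarith)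
      _ = δ * (2 * M + 2) := by ring
      _ ≤ η := hδη
  have hre : (∫ x, conj (F' (eΘ x)) * F' (eσ x) ∂μ).re - (∫ x, conj (F (eΘ x)) * F (eσ x) ∂μ).re ≤
      η := by
    rw [← Complex.sub_re]
    refine (Complex.re_le_norm _).trans ?_
    rw [norm_sub_rev]
    exact key.trans hbound
  linarith

/-- Invariance of a measure under a measurable equivalence, as a substitution rule. [folklore] -/
theorem integral_comp_equiv_eq {E : Type*} [NormedAddCommGroup E] [NormedSpace ℝ E]
    (μ : Measure Ω) (e : Ω ≃ᵐ Ω) (hμ : μ.map e = μ) (f : Ω → E) :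
    ∫ x, f (e x) ∂μ = ∫ x, f x ∂μ := by
  rw [← integral_map_equiv e f, hμ]

end Abstract

/-! ### Odd-torus limit states: invariances and reflection positivity on continuous cylinders -/

section Limit

variable {G : Type} [Group G] [TopologicalSpace G] [IsTopologicalGroup G] [CompactSpace G]
  [MeasurableSpace G] [BorelSpace G]

omit [Group G] [TopologicalSpace G] [IsTopologicalGroup G] [CompactSpace G] [MeasurableSpace G]
  [BorelSpace G] in
/-- Binary combinations of cylinder observables are cylinder observables. [folklore] -/
theorem isCylinder_map₂ {α β γ : Type*} (H : α → β → γ) {F₁ : LGConfig 4 G → α}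
    {F₂ : LGConfig 4 G → β} {Λ₁ Λ₂ : Finset (QuantumLattice.ZdEdge 4)} (h₁ : IsCylinder F₁ Λ₁)
    (h₂ : IsCylinder F₂ Λ₂) : IsCylinder (fun U => H (F₁ U) (F₂ U)) (Λ₁ ∪ Λ₂) := by
  intro U V hUV
  have e₁ : F₁ U = F₁ V := h₁ fun e he => hUV e (by rw [Finset.coe_union]; exact Or.inl he)
  have e₂ : F₂ U = F₂ V := h₂ fun e he => hUV e (by rw [Finset.coe_union]; exact Or.inr he)
  simp only [e₁, e₂]

variable (r : LatticeRep G) {β : ℝ} {μ : Measure (LGConfig 4 G)}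

/-- **Transport of a symmetry of the torus states to the limit state.** If a continuous map `Ψ`
of `ℤ⁴` configurations preserves cylinder observables and, read through the periodic lift,
preserves every odd-torus Wilson expectation, then `∫ F ∘ Ψ dμ = ∫ F dμ` for every bounded
continuous cylinder observable and every odd-torus limit state `μ`. [folklore] -/
theorem integral_comp_eq_of_torus (hμ : μ ∈ oddTorusLimitPoints r β) {Ψ : LGConfig 4 G → LGConfig 4 G}
    (hΨc : Continuous Ψ)
    (hΨcyl : ∀ {F : LGConfig 4 G → ℝ} {Λ : Finset (QuantumLattice.ZdEdge 4)}, IsCylinder F Λ →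
      ∃ Λ' : Finset (QuantumLattice.ZdEdge 4), IsCylinder (F ∘ Ψ) Λ')
    (hΨT : ∀ (S : ℕ) (F : LGConfig 4 G → ℝ),
      wilsonExpectation (L := 2 * S + 1) r.ρ β (toTorusObservable (2 * S + 1) (F ∘ Ψ)) =
        wilsonExpectation (L := 2 * S + 1) r.ρ β (toTorusObservable (2 * S + 1) F))
    (F : LGConfig 4 G → ℝ) (Λ : Finset (QuantumLattice.ZdEdge 4)) (hF : IsCylinder F Λ) (hFc : Continuous F)
    (hFb : ∃ C, ∀ U, |F U| ≤ C) :
    ∫ U, F (Ψ U) ∂μ = ∫ U, F U ∂μ := by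
  obtain ⟨S, hS, -, hlim⟩ := hμ
  obtain ⟨Λ', hΛ'⟩ := hΨcyl hF
  have t1 := hlim (F ∘ Ψ) Λ' hΛ' (hFc.comp hΨc)
    (by obtain ⟨C, hC⟩ := hFb; exact ⟨C, fun U => hC _⟩)
  have t2 := hlim F Λ hF hFc hFb
  simp only [hΨT] at t1
  exact tendsto_nhds_unique t1 t2

/-- **Odd-torus limit states are `Θ`-invariant** (given `CylinderExt`). [folklore] -/
theorem map_gaugeTimeReflect_eq [IsProbabilityMeasure μ] (hμ : μ ∈ oddTorusLimitPoints r β)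
    (hExt : CylinderExt G) : μ.map gaugeTimeReflect = μ := by
  haveI : IsProbabilityMeasure (μ.map gaugeTimeReflect) :=
    Measure.isProbabilityMeasure_map measurable_gaugeTimeReflect.aemeasurable
  refine hExt _ _ fun F Λ hF hFc hFb => ?_
  obtain ⟨e, he⟩ := exists_measurableEquiv_gaugeTimeReflect (G := G)
  rw [← he, integral_map_equiv e, he]
  refine integral_comp_eq_of_torus r hμ continuous_gaugeTimeReflect
    (fun hF => ⟨_, isCylinder_comp_gaugeTimeReflect hF⟩) (fun S F => ?_) F Λ hF hFc hFb
  have h : toTorusObservable (2 * S + 1) (F ∘ gaugeTimeReflect) =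
      (toTorusObservable (2 * S + 1) F ∘ torusConfigShift (Pi.single 0 (-2))) ∘
        GaugeConfig.timeReflect := by
    funext V
    simp only [toTorusObservable, Function.comp_apply, gaugeTimeReflect_torusLift]
  rw [h, wilsonExpectation_comp_timeReflect r.ρ r.continuous, wilsonExpectation_comp_torusConfigShift]

/-- **Odd-torus limit states are `τ`-invariant** (given `CylinderExt`). [folklore] -/
theorem map_gaugeTimeShift_eq [IsProbabilityMeasure μ] (hμ : μ ∈ oddTorusLimitPoints r β)
    (hExt : CylinderExt G) : μ.map gaugeTimeShift = μ := by
  haveI : IsProbabilityMeasure (μ.map gaugeTimeShift) :=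
    Measure.isProbabilityMeasure_map measurable_gaugeTimeShift.aemeasurable
  refine hExt _ _ fun F Λ hF hFc hFb => ?_
  have he : ((configShift (G := G) (-(Pi.single (0 : Fin 4) (1 : ℤ))) :
      LGConfig 4 G ≃ᵐ LGConfig 4 G) : LGConfig 4 G → LGConfig 4 G) = gaugeTimeShift := rfl
  rw [← he, integral_map_equiv, he]
  refine integral_comp_eq_of_torus r hμ continuous_gaugeTimeShift
    (fun hF => ⟨_, isCylinder_comp_gaugeTimeShift hF⟩) (fun S F => ?_) F Λ hF hFc hFb
  have h : toTorusObservable (2 * S + 1) (F ∘ gaugeTimeShift) =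
      toTorusObservable (2 * S + 1) F ∘ torusConfigShift (Pi.single 0 (-1)) := by
    funext V
    simp only [toTorusObservable, Function.comp_apply, gaugeTimeShift_torusLift]
  rw [h, wilsonExpectation_comp_torusConfigShift]

end Limit

end Summit.QuantumFields.YangMills.Theorems.CriticalContinuumLimit.AdmissibleGap

namespace Summit.QuantumFields.YangMills.Theorems.CriticalContinuumLimit

/-- **Registered helper `admissibleGap_limitInvariance`** (stub `stub_admissibleGivesGap`, helper
1/4): odd-torus limit states are invariant under the bond time reflection `Θ` and the unit time
shift `τ` (given `CylinderExt G`). [folklore] -/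
theorem admissibleGap_limitInvariance (G : Type) [Group G] [TopologicalSpace G] [IsTopologicalGroup G]
    [CompactSpace G] [MeasurableSpace G] [BorelSpace G] (r : LatticeRep G) (β : ℝ)
    (μ : Measure (LGConfig 4 G)) [IsProbabilityMeasure μ] (hμ : μ ∈ oddTorusLimitPoints r β)
    (hExt : CylinderExt G) : μ.map gaugeTimeReflect = μ ∧ μ.map gaugeTimeShift = μ :=
  ⟨AdmissibleGap.map_gaugeTimeReflect_eq r hμ hExt, AdmissibleGap.map_gaugeTimeShift_eq r hμ hExt⟩

end Summit.QuantumFields.YangMills.Theorems.CriticalContinuumLimit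

end
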